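import Summits.CriticalPhenomena.CardyFormulaZ2.Theorems.CardyIKTransportIKLinearTransportThetaEnclosureWinding
import Summits.CriticalPhenomena.CardyFormulaZ2.Theorems.CardyIKTransportIKLinearTransportThetaEnclosureRefine

/-!
# `CardyIKTransport.IKLinearTransport` (stmt-CriticalPhenomena-5076, line `pinned-diagram-exchange`, lead c8 wave 1) —
# theta-enclosure, part 3: the lattice Jordan lemma `thetaEnclosure` (registered stub)

Support file (`--supports stmt-CriticalPhenomena-5076`).  THE STATEMENT (`thetaEnclosure`): in the cell triangulation
`cellGraph A` of `ℤ²`, let `γR` be a black (`⊆ K`) cell path in the closed right half-plane `{x ≥ a}` from the wall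
cell `(a, t₁)` to `(a, s₁)`, `γL` a black path in `{x ≤ a}` from `(a, t₂)` to `(a, s₂)`, the wall cells between
`t₁, t₂` and between `s₁, s₂` black, `p = (a, r)` a WHITE wall cell with `max s₁ s₂ < r < min t₁ t₂`, everything within
sup-distance `M` of `p`.  Then every white cell path from `p` stays within sup-distance `M` of `p`: the closed black
curve `γR + (wall run s₁ → s₂) + γL⁻¹ + (wall run t₂ → t₁)` encloses `p`, and paths of different colours of a
triangulation do not cross (Kesten 1982, §2.3, "closed occupied circuits block vacant paths").

THE PROOF.  Refine everything to `ℤ²` at double scale (part 2, `…ThetaEnclosureRefine`: black pieces in mode V,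
the white path in mode H; the refinements are vertex-disjoint by `own_disjoint`; cell paths are refined edge by edge,
`refineV_chain` / `refineH_chain`; the wall runs become straight doubled vertical walks, `exists_wallWalk`).  The four
refined black pieces concatenate to a CLOSED `ℤ²`-walk `C`.  Its winding number (part 1, `…ThetaEnclosureWinding`, on
the engine `walkWinding` of `PlanarDuality`) around the doubled white cell `2p` is `-1`: the wall runs and the left path
lie weakly left of the column `2a` and contribute `0` (`Z2HalfPlane.walkWinding_eq_zero_of_right`), while the right path descends from
height `2t₁ > 2r` to `2s₁ < 2r` and meets the two critical rows `2r, 2r + 1` only strictly right of `2a` (at abscissa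
`2a` these rows hold `2p` and the midpoint above it, owned by the white cell `p`), so it contributes `-1`
(`theta_walkWinding_telescope`).  The winding number of the closed walk `C` is constant along the refined white path
(`walkWinding_closed_const`) and vanishes outside the doubled box of radius `2M` (`walkWinding_closed_box`); hence every
doubled cell `2v` of the white path lies in that box, i.e. `v` is within sup-distance `M` of `p`.
-/

noncomputable section

namespace Summit.CriticalPhenomena.CardyFormulaZ2.Theorems.IKLinearTransport.PinnedDiagramExchange

open Literature.Probability.Percolation Literature.Probability.LatticeModels
open SimpleGraph

namespace ThetaEnclosureStub

/-- Ownership of a doubled vertex by the colour class `S` along refinements in mode V (local notation, as in part 2). -/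
local notation3 "OwnV[" S ", " A "] " z:max =>
  ((∀ i j : ℤ, (z : Site 2) 0 = 2 * i → (z : Site 2) 1 = 2 * j → (![i, j] : Site 2) ∈ S) ∧
    (∀ i j : ℤ, (z : Site 2) 0 = 2 * i + 1 → (z : Site 2) 1 = 2 * j → (![i, j] : Site 2) ∈ S ∨ (![i + 1, j] : Site 2) ∈ S) ∧
    (∀ i j : ℤ, (z : Site 2) 0 = 2 * i → (z : Site 2) 1 = 2 * j + 1 → (![i, j] : Site 2) ∈ S ∧ (![i, j + 1] : Site 2) ∈ S) ∧
    (∀ i j : ℤ, (z : Site 2) 0 = 2 * i + 1 → (z : Site 2) 1 = 2 * j + 1 →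
      ((![i, j] : Site 2) ∉ A → (![i, j] : Site 2) ∈ S ∧ (![i + 1, j + 1] : Site 2) ∈ S) ∧
      ((![i, j] : Site 2) ∈ A → (![i, j + 1] : Site 2) ∈ S ∧ (![i + 1, j] : Site 2) ∈ S)))

/-- Ownership of a doubled vertex by the colour class `S` along refinements in mode H (local notation, as in part 2). -/
local notation3 "OwnH[" S ", " A "] " z:max =>
  ((∀ i j : ℤ, (z : Site 2) 0 = 2 * i → (z : Site 2) 1 = 2 * j → (![i, j] : Site 2) ∈ S) ∧
    (∀ i j : ℤ, (z : Site 2) 0 = 2 * i + 1 → (z : Site 2) 1 = 2 * j → (![i, j] : Site 2) ∈ S ∧ (![i + 1, j] : Site 2) ∈ S) ∧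
    (∀ i j : ℤ, (z : Site 2) 0 = 2 * i → (z : Site 2) 1 = 2 * j + 1 → (![i, j] : Site 2) ∈ S ∨ (![i, j + 1] : Site 2) ∈ S) ∧
    (∀ i j : ℤ, (z : Site 2) 0 = 2 * i + 1 → (z : Site 2) 1 = 2 * j + 1 →
      ((![i, j] : Site 2) ∉ A → (![i, j] : Site 2) ∈ S ∧ (![i + 1, j + 1] : Site 2) ∈ S) ∧
      ((![i, j] : Site 2) ∈ A → (![i, j + 1] : Site 2) ∈ S ∧ (![i + 1, j] : Site 2) ∈ S)))

/-- The doubled bounding box of two cells (local notation, as in part 2). -/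
local notation3 "Box[" u ", " v "] " z:max =>
  ((min (2 * (u : Site 2) 0) (2 * (v : Site 2) 0) ≤ (z : Site 2) 0 ∧ (z : Site 2) 0 ≤ max (2 * (u : Site 2) 0) (2 * (v : Site 2) 0)) ∧
    (min (2 * (u : Site 2) 1) (2 * (v : Site 2) 1) ≤ (z : Site 2) 1 ∧ (z : Site 2) 1 ≤ max (2 * (u : Site 2) 1) (2 * (v : Site 2) 1)))

/-! ### Refinement of cell paths and of the wall runs -/

/-- **Mode V refinement of a black cell path** (a chain of `cellGraph A` with cells in `S`): a `ℤ²`-walk between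
the doubled end cells, through every doubled cell of the chain, all of whose vertices are V-owned by `S` and lie in
the doubled bounding box of two cells of the chain. [folklore] -/
theorem refineV_chain {S A : Set (Site 2)} : ∀ (l : List (Site 2)) (h t : Site 2),
    List.IsChain (cellGraph A).Adj l → l.head? = some h → l.getLast? = some t → (∀ v ∈ l, v ∈ S) →
    ∃ W : (zdGraph 2).Walk (triDouble h) (triDouble t), (∀ v ∈ l, triDouble v ∈ W.support) ∧
      ∀ z ∈ W.support, OwnV[S, A] z ∧ ∃ u ∈ l, ∃ v ∈ l, Box[u, v] z
  | [], _, _, _, hh, _, _ => by simp at hh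
  | [u], h, t, _, hh, ht, hS => by
    simp only [List.head?_cons, Option.some.injEq] at hh
    simp only [List.getLast?_singleton, Option.some.injEq] at ht
    subst hh; subst ht
    refine ⟨Walk.nil, fun v hv => ?_, fun z hz => ?_⟩
    · rw [List.mem_singleton] at hv
      subst hv
      exact Walk.start_mem_support _
    · rw [Walk.support_nil, List.mem_singleton] at hz
      subst hz
      exact ⟨ownV_double (hS u (List.mem_singleton_self u)), u, List.mem_singleton_self u, u,
        List.mem_singleton_self u, boxL⟩
  | u :: v :: rest, h, t, hc, hh, ht, hS => by
    rw [List.isChain_cons_cons] at hc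
    simp only [List.head?_cons, Option.some.injEq] at hh
    subst hh
    rw [List.getLast?_cons_cons] at ht
    obtain ⟨W', hmem', hW'⟩ := refineV_chain (v :: rest) v t hc.2 rfl ht
      (fun w hw => hS w (List.mem_cons_of_mem _ hw))
    obtain ⟨W₁, hW₁⟩ := refineV_adj hc.1 (hS u (by simp)) (hS v (by simp))
    refine ⟨W₁.append W', fun w hw => ?_, fun z hz => ?_⟩
    · rw [Walk.mem_support_append_iff]
      rw [List.mem_cons] at hw
      rcases hw with rfl | hw
      · exact Or.inl (Walk.start_mem_support _)
      · exact Or.inr (hmem' w hw)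
    · rw [Walk.mem_support_append_iff] at hz
      rcases hz with hz | hz
      · exact ⟨(hW₁ z hz).1, u, by simp, v, by simp, (hW₁ z hz).2⟩
      · obtain ⟨hown, u', hu', v', hv', hbox⟩ := hW' z hz
        exact ⟨hown, u', List.mem_cons_of_mem _ hu', v', List.mem_cons_of_mem _ hv', hbox⟩

/-- **Mode H refinement of a white cell path**: as `refineV_chain`, with H-ownership. [folklore] -/
theorem refineH_chain {S A : Set (Site 2)} : ∀ (l : List (Site 2)) (h t : Site 2),
    List.IsChain (cellGraph A).Adj l → l.head? = some h → l.getLast? = some t → (∀ v ∈ l, v ∈ S) →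
    ∃ W : (zdGraph 2).Walk (triDouble h) (triDouble t), (∀ v ∈ l, triDouble v ∈ W.support) ∧
      ∀ z ∈ W.support, OwnH[S, A] z ∧ ∃ u ∈ l, ∃ v ∈ l, Box[u, v] z
  | [], _, _, _, hh, _, _ => by simp at hh
  | [u], h, t, _, hh, ht, hS => by
    simp only [List.head?_cons, Option.some.injEq] at hh
    simp only [List.getLast?_singleton, Option.some.injEq] at ht
    subst hh; subst ht
    refine ⟨Walk.nil, fun v hv => ?_, fun z hz => ?_⟩
    · rw [List.mem_singleton] at hv
      subst hv
      exact Walk.start_mem_support _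
    · rw [Walk.support_nil, List.mem_singleton] at hz
      subst hz
      exact ⟨ownH_double (hS u (List.mem_singleton_self u)), u, List.mem_singleton_self u, u,
        List.mem_singleton_self u, boxL⟩
  | u :: v :: rest, h, t, hc, hh, ht, hS => by
    rw [List.isChain_cons_cons] at hc
    simp only [List.head?_cons, Option.some.injEq] at hh
    subst hh
    rw [List.getLast?_cons_cons] at ht
    obtain ⟨W', hmem', hW'⟩ := refineH_chain (v :: rest) v t hc.2 rfl ht
      (fun w hw => hS w (List.mem_cons_of_mem _ hw))
    obtain ⟨W₁, hW₁⟩ := refineH_adj hc.1 (hS u (by simp)) (hS v (by simp))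
    refine ⟨W₁.append W', fun w hw => ?_, fun z hz => ?_⟩
    · rw [Walk.mem_support_append_iff]
      rw [List.mem_cons] at hw
      rcases hw with rfl | hw
      · exact Or.inl (Walk.start_mem_support _)
      · exact Or.inr (hmem' w hw)
    · rw [Walk.mem_support_append_iff] at hz
      rcases hz with hz | hz
      · exact ⟨(hW₁ z hz).1, u, by simp, v, by simp, (hW₁ z hz).2⟩
      · obtain ⟨hown, u', hu', v', hv', hbox⟩ := hW' z hz
        exact ⟨hown, u', List.mem_cons_of_mem _ hu', v', List.mem_cons_of_mem _ hv', hbox⟩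

/-- The doubled wall run `{2a} × [2 lo, 2 hi]` over black wall cells `(a, y)`, `lo ≤ y ≤ hi`, is V-owned by `K`.
[folklore] -/
theorem ownV_wall {K A : Set (Site 2)} {z : Site 2} {a lo hi : ℤ}
    (hK : ∀ y : ℤ, lo ≤ y → y ≤ hi → (![a, y] : Site 2) ∈ K)
    (h0 : z 0 = 2 * a) (hlo : 2 * lo ≤ z 1) (hhi : z 1 ≤ 2 * hi) : OwnV[K, A] z := by
  refine ⟨fun i' j' h0' h1' => ?_, fun i' j' h0' h1' => by omega, fun i' j' h0' h1' => ?_,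
    fun i' j' h0' h1' => by omega⟩
  · obtain rfl : i' = a := by omega
    exact hK j' (by omega) (by omega)
  · obtain rfl : i' = a := by omega
    exact ⟨hK j' (by omega) (by omega), hK (j' + 1) (by omega) (by omega)⟩

/-- **Refinement of a black wall run**: the straight doubled vertical walk from `2 (a, m)` to `2 (a, n)` (in either
direction), V-owned by `K` when the wall cells `(a, y)`, `min m n ≤ y ≤ max m n`, are black. [folklore] -/
theorem exists_wallWalk {K A : Set (Site 2)} (a m n : ℤ)
    (hK : ∀ y : ℤ, min m n ≤ y → y ≤ max m n → (![a, y] : Site 2) ∈ K) :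
    ∃ W : (zdGraph 2).Walk (triDouble ![a, m]) (triDouble ![a, n]),
      ∀ z ∈ W.support, OwnV[K, A] z ∧ z 0 = 2 * a ∧ 2 * min m n ≤ z 1 ∧ z 1 ≤ 2 * max m n := by
  rcases le_or_gt m n with hmn | hmn
  · obtain ⟨W, hW⟩ := exists_vertWalk (2 * (n - m)).toNat (triDouble ![a, m]) (triDouble ![a, n]) (by simp)
      (by simp only [triDouble_apply_one, Matrix.cons_val_one, Matrix.cons_val_fin_one]; rw [Int.toNat_of_nonneg (by omega)]; ring)
    refine ⟨W, fun z hz => ?_⟩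
    have h := hW z hz
    simp only [triDouble_apply_zero, triDouble_apply_one, Matrix.cons_val_zero, Matrix.cons_val_one, Matrix.cons_val_fin_one] at h
    exact ⟨ownV_wall hK h.1 (by omega) (by omega), h.1, by omega, by omega⟩
  · obtain ⟨W, hW⟩ := exists_vertWalk (2 * (m - n)).toNat (triDouble ![a, n]) (triDouble ![a, m]) (by simp)
      (by simp only [triDouble_apply_one, Matrix.cons_val_one, Matrix.cons_val_fin_one]; rw [Int.toNat_of_nonneg (by omega)]; ring)
    refine ⟨W.reverse, fun z hz => ?_⟩
    rw [Walk.support_reverse, List.mem_reverse] at hz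
    have h := hW z hz
    simp only [triDouble_apply_zero, triDouble_apply_one, Matrix.cons_val_zero, Matrix.cons_val_one, Matrix.cons_val_fin_one] at h
    exact ⟨ownV_wall hK h.1 (by omega) (by omega), h.1, by omega, by omega⟩

end ThetaEnclosureStub

open ThetaEnclosureStub in
/-- **Theta-enclosure (lattice Jordan lemma for the cell triangulation; registered stub `thetaEnclosure` of the line
`pinned-diagram-exchange`).**  In the cell triangulation `cellGraph A` let `γR ⊆ K ∩ {x ≥ a}` be a cell path from the
wall cell `(a, t₁)` to `(a, s₁)`, `γL ⊆ K ∩ {x ≤ a}` a cell path from `(a, t₂)` to `(a, s₂)`, let the wall cells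
`(a, y)` with `y` between `t₁, t₂` and between `s₁, s₂` lie in `K`, let `max s₁ s₂ < r < min t₁ t₂` with `(a, r) ∉ K`,
and let all of this lie within sup-distance `M` of `(a, r)`.  Then every cell path off `K` starting at `(a, r)` stays
within sup-distance `M` of `(a, r)`: a closed black curve of a triangulation encloses the white cells inside it
(Kesten 1982, §2.3, closed occupied circuits block vacant paths; proved through the doubling refinement and the
discrete winding number, see the module docstring). [folklore] -/
theorem thetaEnclosure : ∀ (A K : Set (Site 2)) (a r : ℤ) (M : ℕ) (γR γL : List (Site 2)) (t₁ s₁ t₂ s₂ : ℤ), List.IsChain (cellGraph A).Adj γR → (∀ v ∈ γR, v ∈ K ∧ a ≤ v 0) → γR.head? = some ![a, t₁] → γR.getLast? = some ![a, s₁] → List.IsChain (cellGraph A).Adj γL → (∀ v ∈ γL, v ∈ K ∧ v 0 ≤ a) → γL.head? = some ![a, t₂] → γL.getLast? = some ![a, s₂] → (∀ y : ℤ, min t₁ t₂ ≤ y → y ≤ max t₁ t₂ → ![a, y] ∈ K) → (∀ y : ℤ, min s₁ s₂ ≤ y → y ≤ max s₁ s₂ → ![a, y] ∈ K) → max s₁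 s₂ < r → r < min t₁ t₂ → ![a, r] ∉ K → (∀ v ∈ γR, |v 0 - a| ≤ M ∧ |v 1 - r| ≤ M) → (∀ v ∈ γL, |v 0 - a| ≤ M ∧ |v 1 - r| ≤ M) → |t₁ - r| ≤ M → |t₂ - r| ≤ M → |s₁ - r| ≤ M → |s₂ - r| ≤ M → ∀ π : List (Site 2), List.IsChain (cellGraph A).Adj π → (∀ v ∈ π, v ∉ K) → π.head? = some ![a, r] → ∀ v ∈ π, |v 0 - a| ≤ M ∧ |v 1 - r| ≤ M := by
  intro A K a r M γR γL t₁ s₁ t₂ s₂ hcR hKR hhR htR hcL hKL hhL htL hKt hKs hsr hrt hp hMR hML hMt₁ hMt₂ hMs₁ hMs₂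
    π hcπ hKπ hhπ v hv
  -- the four black pieces, refined in mode V, and the closed black curve `C`
  obtain ⟨R, -, hR⟩ := refineV_chain (S := K) (A := A) γR _ _ hcR hhR htR fun w hw => (hKR w hw).1
  obtain ⟨L, -, hL⟩ := refineV_chain (S := K) (A := A) γL _ _ hcL hhL htL fun w hw => (hKL w hw).1
  obtain ⟨Sw, hSw⟩ := exists_wallWalk (K := K) (A := A) a s₁ s₂ hKs
  obtain ⟨Tw, hTw⟩ := exists_wallWalk (K := K) (A := A) a t₂ t₁ fun y h1 h2 =>
    hKt y (by rw [min_comm]; exact h1) (by rw [max_comm]; exact h2)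
  set C := R.append (Sw.append (L.reverse.append Tw)) with hC
  have hCmem : ∀ z ∈ C.support, z ∈ R.support ∨ z ∈ Sw.support ∨ z ∈ L.support ∨ z ∈ Tw.support := by
    intro z hz
    simp only [hC, Walk.mem_support_append_iff, Walk.support_reverse, List.mem_reverse] at hz
    tauto
  -- the white path, refined in mode H, avoids `C`
  obtain ⟨tπ, htπ⟩ : ∃ t, π.getLast? = some t := by
    cases π with
    | nil => simp at hhπ
    | cons x l => exact ⟨_, List.getLast?_eq_some_getLast (List.cons_ne_nil x l)⟩
  obtain ⟨P, hmemP, hP⟩ := refineH_chain (S := Kᶜ) (A := A) π _ _ hcπ hhπ htπ fun w hw => hKπ w hw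
  have hdisj : ∀ z ∈ P.support, z ∉ C.support := by
    intro z hzP hzC
    rcases hCmem z hzC with hz | hz | hz | hz
    · exact own_disjoint (hR z hz).1 (hP z hzP).1
    · exact own_disjoint (hSw z hz).1 (hP z hzP).1
    · exact own_disjoint (hL z hz).1 (hP z hzP).1
    · exact own_disjoint (hTw z hz).1 (hP z hzP).1
  -- `C` lies in the doubled box of radius `2M` around `2p`
  have habs : ∀ {x c : ℤ}, |x - c| ≤ (M : ℤ) → c - M ≤ x ∧ x ≤ c + M := fun h => by
    have := abs_le.1 h; omega
  have hCbox : ∀ z ∈ C.support,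
      2 * a - 2 * M ≤ z 0 ∧ z 0 ≤ 2 * a + 2 * M ∧ 2 * r - 2 * M ≤ z 1 ∧ z 1 ≤ 2 * r + 2 * M := by
    intro z hz
    rcases hCmem z hz with hz | hz | hz | hz
    · obtain ⟨-, u, hu, w, hw, hbox⟩ := hR z hz
      have h1 := habs (hMR u hu).1; have h2 := habs (hMR u hu).2
      have h3 := habs (hMR w hw).1; have h4 := habs (hMR w hw).2
      omega
    · have h := (hSw z hz).2
      have h1 := habs hMs₁; have h2 := habs hMs₂
      omega
    · obtain ⟨-, u, hu, w, hw, hbox⟩ := hL z hz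
      have h1 := habs (hML u hu).1; have h2 := habs (hML u hu).2
      have h3 := habs (hML w hw).1; have h4 := habs (hML w hw).2
      omega
    · have h := (hTw z hz).2
      have h1 := habs hMt₁; have h2 := habs hMt₂
      omega
  -- the winding number of `C` around the doubled white wall cell `2p` is `-1`
  have hs₁ : s₁ < r := lt_of_le_of_lt (le_max_left _ _) hsr
  have ht₁ : r < t₁ := lt_of_lt_of_le hrt (min_le_left _ _)
  have hWR : walkWinding R (triDouble ![a, r]) = -1 := by
    rw [walkWinding_telescope R _ ?_]
    · simp only [triDouble_apply_one, Matrix.cons_val_one, Matrix.cons_val_fin_one]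
      rw [if_neg (by omega), if_pos (by omega)]
      norm_num
    · intro z hz hz1
      obtain ⟨hown, u, hu, w, hw, hbox⟩ := hR z hz
      have hu0 := (hKR u hu).2
      have hw0 := (hKR w hw).2
      simp only [triDouble_apply_zero, triDouble_apply_one, Matrix.cons_val_zero, Matrix.cons_val_one, Matrix.cons_val_fin_one] at hz1 ⊢
      by_contra hlt
      have hz0 : z 0 = 2 * a := by omega
      rcases hz1 with hz1 | hz1
      · exact hp (hown.1 a r hz0 hz1)
      · exact hp (hown.2.2.1 a r hz0 hz1).1
  have hWS : walkWinding Sw (triDouble ![a, r]) = 0 :=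
    Z2HalfPlane.walkWinding_eq_zero_of_right fun z hz => by
      have := (hSw z hz).2.1
      simp only [triDouble_apply_zero, Matrix.cons_val_zero]; omega
  have hWL : walkWinding L (triDouble ![a, r]) = 0 :=
    Z2HalfPlane.walkWinding_eq_zero_of_right fun z hz => by
      obtain ⟨-, u, hu, w, hw, hbox⟩ := hL z hz
      have hu0 := (hKL u hu).2
      have hw0 := (hKL w hw).2
      simp only [triDouble_apply_zero, Matrix.cons_val_zero]; omega
  have hWT : walkWinding Tw (triDouble ![a, r]) = 0 :=
    Z2HalfPlane.walkWinding_eq_zero_of_right fun z hz => by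
      have := (hTw z hz).2.1
      simp only [triDouble_apply_zero, Matrix.cons_val_zero]; omega
  have hWC : walkWinding C (triDouble ![a, r]) = -1 := by
    simp only [hC, walkWinding_append, walkWinding_reverse, hWR, hWS, hWL, hWT]; norm_num
  -- constancy along the white path, and the box
  have hv' : walkWinding C (triDouble v) ≠ 0 := by
    rw [walkWinding_closed_const C P hdisj (triDouble v) (hmemP v hv), hWC]; norm_num
  have hbox := walkWinding_closed_box C hCbox hv'
  simp only [triDouble_apply_zero, triDouble_apply_one] at hbox
  exact ⟨abs_le.2 ⟨by omega, by omega⟩, abs_le.2 ⟨by omega, by omega⟩⟩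

end Summit.CriticalPhenomena.CardyFormulaZ2.Theorems.IKLinearTransport.PinnedDiagramExchange

end
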